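import Mathlib
import Summits.MatrixMultiplication.Statement
import Summits.MatrixMultiplication.MatrixMultiplication.Theorems.GraphEquationsOneOneSyzygies

/-!
# Top-weight syzygies of the product matrix (`GraphEquations`, M39): weights 5 and 6

Decomp-mm node «GraphEquations» (lens 5 «finite range + asymptotic regime + bridge», g38); attacked
leaf `MultiplicityReduction` (stmt-MatrixMultiplication-27806).  Target of the node, VERBATIM:
`_root_.MatrixMultiplication`.  Route-neutral (`closes` unchanged); imports no `Theses/` file.

Companion of `GraphEquationsOneOneSyzygies` (weight `4`, block `(1,1)`) and
`GraphEquationsOneSidedSyzygies` (weights `3, 4`, blocks `(d,0)`, `(0,d)`).  With `φ_q = (AB)_q` and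
evaluated identities (polynomial functions of `A, B`):
* WEIGHT 6 — `eq_zero_of_vanishing_on_products`: a polynomial `K ∈ ℂ[c]` with `K(AB) = 0` for all
  `A, B` is `0` (take `B = 1`; `φ` is dominant).
* WEIGHT 5 — `symm_eq_zero_of_left_quad_syzygy`: if `Σ_{q,q'} α_{qq'}(A)·(AB)_q·(AB)_{q'} = 0` for
  all `A, B` with `α_{qq'} ∈ ℂ[A]` (any degree), then `α_{qq'} + α_{q'q} = 0`; and the mirror
  statement `symm_eq_zero_of_right_quad_syzygy` for `α_{qq'} ∈ ℂ[B]`.  Proof: substitute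
  `B = adj(A)·C` (resp. `A = C·adj(B)`), so `AB = det(A)·C` and the identity becomes
  `det(A)²·Σ α_{qq'}(A) C_q C_{q'} = 0` for all `C`; polarize in `C`; the polynomial
  `det X·(α_{qq'} + α_{q'q})` then vanishes identically, and `det X ≠ 0` in the domain `ℂ[X]`
  (`Matrix.det_mvPolynomialX_ne_zero`).
USE (NODE-g38 §2): in the cubic normal form `I(W_n)_{≤3} = ℂ[u,c]_{≤1}·⟨f⟩` (`n ≥ 3`) the
`c`-Taylor identity `T₀ + Σ T_q φ_q + Σ T_{qq'} φ_q φ_{q'} + Σ T_{qq'q''} φ_q φ_{q'} φ_{q''} = 0`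
is peeled by `u`-degree: degree `6` kills the `c`-cubic part (this file, weight 6), degree `5`
makes `T_{qq'}` constant (this file, weight 5, after the bidegree split `(3,2) ⊕ (2,3)`), degree
`4` is `GraphEquationsOneSidedSyzygies` + the Koszul theorem, degree `3` is one-sided again.  So
every syzygy input of the normal form is now kernel-checked; only the bookkeeping is on paper.
Why strictly weaker than the summit: identities about the generic product matrix at fixed `n`;
no cost, no exponent.  No `sorry`.
-/

-- dupNamespace: forced by the nested Summit.MatrixMultiplication.MatrixMultiplication layout (D-0017)
set_option linter.dupNamespace false

noncomputable section

namespace Summit.MatrixMultiplication.MatrixMultiplication.Theorems.GraphEquations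

open MvPolynomial

variable {n : ℕ}

/-! ## Matrices of index functions -/

/-- The square matrix of a function on index pairs. -/
def toMat (A : Fin n × Fin n → ℂ) : Matrix (Fin n) (Fin n) ℂ := Matrix.of fun i j => A (i, j)

/-- `toMat A i j = A (i, j)`. -/
@[simp] theorem toMat_apply (A : Fin n × Fin n → ℂ) (i j : Fin n) : toMat A i j = A (i, j) := rfl

/-- `(AB)_q` is the matrix product entry. -/
theorem prodEntry_eq_mul_apply (q : Fin n × Fin n) (A B : Fin n × Fin n → ℂ) :
    prodEntry q A B = (toMat A * toMat B) q.1 q.2 := by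
  simp [prodEntry, Matrix.mul_apply]

/-- The identity matrix as an index function. -/
def idFun : Fin n × Fin n → ℂ := fun v => if v.1 = v.2 then 1 else 0

/-- `A·1 = A`. -/
theorem prodEntry_idFun (q : Fin n × Fin n) (A : Fin n × Fin n → ℂ) :
    prodEntry q A idFun = A q := by
  obtain ⟨q₁, q₂⟩ := q
  simp only [prodEntry, idFun, mul_ite, mul_one, mul_zero]
  simp [Finset.sum_ite_eq']

/-- Evaluating `det X` of the generic matrix at `A` gives `det A`. -/
theorem eval_det_mvPolynomialX (A : Fin n × Fin n → ℂ) :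
    eval A (Matrix.mvPolynomialX (Fin n) (Fin n) ℂ).det = (toMat A).det := by
  rw [RingHom.map_det]
  congr 1
  ext i j
  simp [Matrix.mvPolynomialX_apply]

/-- `det X·S` vanishes at every `A` iff at each `A` either `det A = 0` or `S(A) = 0`; then `S = 0`. -/
theorem eq_zero_of_det_mul_vanishing {S : MvPolynomial (Fin n × Fin n) ℂ}
    (h : ∀ A : Fin n × Fin n → ℂ, (toMat A).det ≠ 0 → eval A S = 0) : S = 0 := by
  have hXS : (Matrix.mvPolynomialX (Fin n) (Fin n) ℂ).det * S = 0 := by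
    apply MvPolynomial.funext
    intro A
    rw [map_mul, eval_det_mvPolynomialX, map_zero]
    by_cases hA : (toMat A).det = 0
    · rw [hA, zero_mul]
    · rw [h A hA, mul_zero]
  exact (mul_eq_zero.mp hXS).resolve_left (Matrix.det_mvPolynomialX_ne_zero (Fin n) ℂ)

/-! ## Weight 6: `φ` is dominant -/

/-- **Weight 6.**  A polynomial in the entries of `AB` vanishing for all `A, B` is zero. -/
theorem eq_zero_of_vanishing_on_products {K : MvPolynomial (Fin n × Fin n) ℂ}
    (h : ∀ A B : Fin n × Fin n → ℂ, eval (fun q => prodEntry q A B) K = 0) : K = 0 := by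
  apply MvPolynomial.funext
  intro A
  have h1 := h A idFun
  simp only [prodEntry_idFun] at h1
  simpa using h1

/-! ## Weight 5: one-sided quadratic syzygies have vanishing symmetric part -/

/-- Coefficient families `α_{qq'} ∈ ℂ[X]` indexed by ordered pairs. -/
abbrev TwoSided (n : ℕ) : Type :=
  Fin n × Fin n → Fin n × Fin n → MvPolynomial (Fin n × Fin n) ℂ

/-- The bilinear form `Σ_{q,q'} α_{qq'}(P)·x_q·y_{q'}` with coefficients evaluated at `P`. -/
def bilFormEval (α : TwoSided n) (P x y : Fin n × Fin n → ℂ) : ℂ :=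
  ∑ q : Fin n × Fin n, ∑ q' : Fin n × Fin n, eval P (α q q') * x q * y q'

/-- `Σ_{q,q'} α_{qq'}(A)·(AB)_q·(AB)_{q'}` (coefficients in `A`). -/
def leftQuadSyzEval (α : TwoSided n) (A B : Fin n × Fin n → ℂ) : ℂ :=
  bilFormEval α A (fun q => prodEntry q A B) (fun q => prodEntry q A B)

/-- `Σ_{q,q'} α_{qq'}(B)·(AB)_q·(AB)_{q'}` (coefficients in `B`). -/
def rightQuadSyzEval (α : TwoSided n) (A B : Fin n × Fin n → ℂ) : ℂ :=
  bilFormEval α B (fun q => prodEntry q A B) (fun q => prodEntry q A B)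

/-- Coordinate vector `e_q`. -/
def unitVec (q : Fin n × Fin n) : Fin n × Fin n → ℂ := fun v => if v = q then 1 else 0

/-- `B(e_q, e_{q'}) = α_{qq'}(P)`. -/
theorem bilFormEval_unitVec (α : TwoSided n) (P : Fin n × Fin n → ℂ) (q q' : Fin n × Fin n) :
    bilFormEval α P (unitVec q) (unitVec q') = eval P (α q q') := by
  unfold bilFormEval unitVec
  rw [Finset.sum_eq_single q, Finset.sum_eq_single q']
  · simp
  all_goals first
    | (intro b _ hb; simp [hb])
    | simp

/-- Bilinearity: `B(x + y, x + y) − B(x,x) − B(y,y) = B(x,y) + B(y,x)` (polarization). -/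
theorem bilFormEval_polar (α : TwoSided n) (P x y : Fin n × Fin n → ℂ) :
    bilFormEval α P (x + y) (x + y) - bilFormEval α P x x - bilFormEval α P y y =
      bilFormEval α P x y + bilFormEval α P y x := by
  simp only [bilFormEval, Pi.add_apply, ← Finset.sum_sub_distrib, ← Finset.sum_add_distrib]
  refine Finset.sum_congr rfl fun q _ => Finset.sum_congr rfl fun q' _ => ?_
  ring

/-- A quadratic form vanishing identically has vanishing symmetrised coefficients. -/
theorem symm_eval_eq_zero_of_quadForm (α : TwoSided n) (P : Fin n × Fin n → ℂ)
    (h : ∀ x : Fin n × Fin n → ℂ, bilFormEval α P x x = 0) (q q' : Fin n × Fin n) :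
    eval P (α q q') + eval P (α q' q) = 0 := by
  have := bilFormEval_polar α P (unitVec q) (unitVec q')
  rw [h, h, h, bilFormEval_unitVec, bilFormEval_unitVec] at this
  simpa using this.symm

/-- `A·(adj(A)·C) = det(A)·C`, entrywise. -/
theorem prodEntry_adjugate_mul (A C : Fin n × Fin n → ℂ) (q : Fin n × Fin n) :
    prodEntry q A (fun v => ((toMat A).adjugate * toMat C) v.1 v.2) = (toMat A).det * C q := by
  rw [prodEntry_eq_mul_apply]
  have hM : toMat (fun v : Fin n × Fin n => ((toMat A).adjugate * toMat C) v.1 v.2) =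
      (toMat A).adjugate * toMat C := by
    ext i j; rfl
  rw [hM, ← Matrix.mul_assoc, Matrix.mul_adjugate, Matrix.smul_mul, Matrix.one_mul,
    Matrix.smul_apply, smul_eq_mul, toMat_apply]

/-- `(C·adj(B))·B = det(B)·C`, entrywise. -/
theorem prodEntry_mul_adjugate (B C : Fin n × Fin n → ℂ) (q : Fin n × Fin n) :
    prodEntry q (fun v => (toMat C * (toMat B).adjugate) v.1 v.2) B = (toMat B).det * C q := by
  rw [prodEntry_eq_mul_apply]
  have hM : toMat (fun v : Fin n × Fin n => (toMat C * (toMat B).adjugate) v.1 v.2) =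
      toMat C * (toMat B).adjugate := by
    ext i j; rfl
  rw [hM, Matrix.mul_assoc, Matrix.adjugate_mul, Matrix.mul_smul, Matrix.mul_one,
    Matrix.smul_apply, smul_eq_mul, toMat_apply]

/-- Scaling both arguments of the bilinear form: `B(d·x, d·x) = d²·B(x,x)`. -/
theorem bilFormEval_smul (α : TwoSided n) (P x : Fin n × Fin n → ℂ) (d : ℂ) :
    bilFormEval α P (fun q => d * x q) (fun q => d * x q) = d ^ 2 * bilFormEval α P x x := by
  simp only [bilFormEval, Finset.mul_sum]
  refine Finset.sum_congr rfl fun q _ => Finset.sum_congr rfl fun q' _ => ?_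
  ring

/-- **Weight 5, left.**  `Σ_{q,q'} α_{qq'}(A)·(AB)_q(AB)_{q'} ≡ 0` with `α_{qq'} ∈ ℂ[A]` forces
`α_{qq'} + α_{q'q} = 0` for all `q, q'`. -/
theorem symm_eq_zero_of_left_quad_syzygy {α : TwoSided n} (h : ∀ A B, leftQuadSyzEval α A B = 0)
    (q q' : Fin n × Fin n) : α q q' + α q' q = 0 := by
  apply eq_zero_of_det_mul_vanishing
  intro A hA
  rw [map_add]
  apply symm_eval_eq_zero_of_quadForm α A _ q q'
  intro x
  -- substitute `B = adj(A)·X`: `AB = det(A)·x`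
  have h1 := h A (fun v => ((toMat A).adjugate * toMat x) v.1 v.2)
  simp only [leftQuadSyzEval, prodEntry_adjugate_mul, bilFormEval_smul] at h1
  exact (mul_eq_zero.mp h1).resolve_left (pow_ne_zero 2 hA)

/-- **Weight 5, right.**  `Σ_{q,q'} α_{qq'}(B)·(AB)_q(AB)_{q'} ≡ 0` with `α_{qq'} ∈ ℂ[B]` forces
`α_{qq'} + α_{q'q} = 0` for all `q, q'`. -/
theorem symm_eq_zero_of_right_quad_syzygy {α : TwoSided n}
    (h : ∀ A B, rightQuadSyzEval α A B = 0) (q q' : Fin n × Fin n) : α q q' + α q' q = 0 := by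
  apply eq_zero_of_det_mul_vanishing
  intro B hB
  rw [map_add]
  apply symm_eval_eq_zero_of_quadForm α B _ q q'
  intro x
  -- substitute `A = X·adj(B)`: `AB = det(B)·x`
  have h1 := h (fun v => (toMat x * (toMat B).adjugate) v.1 v.2) B
  simp only [rightQuadSyzEval, prodEntry_mul_adjugate, bilFormEval_smul] at h1
  exact (mul_eq_zero.mp h1).resolve_left (pow_ne_zero 2 hB)

/-- In particular a SYMMETRIC one-sided family (`α_{qq'} = α_{q'q}`, the natural normalisation of
the coefficients of `Σ T_{qq'} c_q c_{q'}`) with a vanishing quadratic syzygy is zero. -/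
theorem eq_zero_of_left_quad_syzygy_of_symm {α : TwoSided n} (hs : ∀ q q', α q q' = α q' q)
    (h : ∀ A B, leftQuadSyzEval α A B = 0) : α = 0 := by
  funext q q'
  have h2 := symm_eq_zero_of_left_quad_syzygy h q q'
  rw [← hs q q', ← two_mul, mul_eq_zero] at h2
  exact h2.resolve_left two_ne_zero

end Summit.MatrixMultiplication.MatrixMultiplication.Theorems.GraphEquations

end
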